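import Literature.AnabelianGeometry.EtaleTheta.SettingModel2Coverings
import Literature.AnabelianGeometry.EtaleTheta.SettingModel
import HarnessLib

/-!
# A FINER model of the [EtTh] §1 root, part C: `ThetaSetting.model₂ p`, its guard, and `hYcl` HOLDS

Mochizuki, *The étale theta function …*, Publ. RIMS **45** (2009) [EtTh], §1, PRIMS PDF pp. 11–14
[cite: MochizukiEtTh2009, §1 p.12]. Layer L2 of the abc-iut cell, seat abc-iut-L2-t1 (root owner); LAST file
of the finer model (`SettingModel2Curve`, `SettingModel2Theta`, `SettingModel2Coverings`): `Π^tp_X := (F̂₂ ×_Ẑ ℤ) × G_{ℚ_p}` with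
abc-iut-w5-d218's tempered fibre product as geometric factor, `K := ℚ_p`, `q_X := p²`; theta quotients by the
pulled-back closures of `[[Δ_X,Δ_X],Δ_X]`, `[Δ_X,Δ_X]`; `Π^tp_X ↠ Z := pr₂`; `Y_N`, `Z_N` from the PROFINITE
level maps `ĥ_N : F̂₂ → Heis(ℤ/N)` (`Δ^tp_{Y_N} = Ker pr₂ ∩ ĥ_N⁻¹{x = y = 0}`, `Δ^tp_{Z_N} = Ker pr₂ ∩ Ker ĥ_N`)
times `G_{K_N}`, `G_{J_N}`. RESULTS: `ThetaSetting.model₂ p : ThetaSetting p`, `model₂_isEtThOrigin`, and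
**`hYcl_model₂`** — the closedness binder of GAP G-w4d021-2 HOLDS here (the image of `Δ^tp_Y` in `Π_X` is
`Ker ê × 1`, closed), whence `exists_isEtThOrigin_and_hYcl`: root + guard + `hYcl` are JOINTLY SATISFIABLE
(so abc-iut-L2-d1's `Δ_Θ ≃* Ẑ` chain is non-vacuously hypothesised), complementing
`SettingModelIndependence.hYcl_not_derivable`. Consistency evidence only (arithmetic factor split, no
cyclotomic action, no points); nothing of [EtTh] asserted; no side taken on [IUTchIII] Cor. 3.12.
-/

noncomputable section

namespace Literature.AnabelianGeometry.EtaleTheta.SettingModel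

open Literature.AnabelianGeometry.SemiGraphs
open CategoryTheory Function
open scoped commutatorElement

variable (p : ℕ) [Fact p.Prime]

/-! ### Theta quotients over `curve₂` -/

/-- `(Π^tp_X)^Θ` of the finer model. [cite: MochizukiEtTh2009, §1 p.12] -/
abbrev GTheta₂ : Type := PiTp₂ p ⧸ KTheta₂ p

/-- `(Π^tp_X)^ell` of the finer model. [cite: MochizukiEtTh2009, §1 p.12] -/
abbrev GEll₂ : Type := PiTp₂ p ⧸ KEll₂ p

/-- `Π^tp_X ↠ (Π^tp_X)^Θ`. [cite: MochizukiEtTh2009, §1 p.12] -/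
def toThetaM₂ : PiTp₂ p →* GTheta₂ p := QuotientGroup.mk' (KTheta₂ p)

/-- `(Π^tp_X)^Θ ↠ (Π^tp_X)^ell`. [cite: MochizukiEtTh2009, §1 p.12] -/
def thetaToEllM₂ : GTheta₂ p →* GEll₂ p :=
  QuotientGroup.map (KTheta₂ p) (KEll₂ p) (MonoidHom.id _) (fun x hx => by simpa using KTheta₂_le_KEll₂ p hx)

/-- [cite: MochizukiEtTh2009, §1 p.12] -/
theorem thetaToEllM₂_comp : (thetaToEllM₂ p).comp (toThetaM₂ p) = QuotientGroup.mk' (KEll₂ p) := by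
  ext x; rfl

/-- [cite: MochizukiEtTh2009, §1 p.12] -/
theorem ker_toEllM₂ : ((thetaToEllM₂ p).comp (toThetaM₂ p)).ker = KEll₂ p := by
  rw [thetaToEllM₂_comp]; exact QuotientGroup.ker_mk' _

/-- [cite: MochizukiEtTh2009, §1 p.12] -/
theorem mk_mem_ker_thetaToEllM₂_iff (x : PiTp₂ p) :
    (x : GTheta₂ p) ∈ (thetaToEllM₂ p).ker ↔ x ∈ KEll₂ p := by
  rw [MonoidHom.mem_ker]
  show thetaToEllM₂ p (toThetaM₂ p x) = 1 ↔ _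
  rw [← MonoidHom.comp_apply, thetaToEllM₂_comp, QuotientGroup.mk'_apply, QuotientGroup.eq_one_iff]

/-- [folklore] -/
private theorem mul_div_mul_eq_comm {G : Type*} [Group G] (a b : G) : a * b / (b * a) = ⁅a, b⁆ := by
  rw [commutatorElement_def, div_eq_mul_inv, mul_inv_rev, ← mul_assoc]

/-- `Δ_Θ` is commutative in the finer model. [cite: MochizukiEtTh2009, §1 p.12] -/
theorem ker_thetaToEllM₂_comm :
    ∀ x ∈ (thetaToEllM₂ p).ker, ∀ y ∈ (thetaToEllM₂ p).ker, x * y = y * x := by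
  intro x hx y hy
  obtain ⟨a, rfl⟩ := QuotientGroup.mk_surjective x
  obtain ⟨b, rfl⟩ := QuotientGroup.mk_surjective y
  have ha := (mk_mem_ker_thetaToEllM₂_iff p a).mp hx
  have hb := (mk_mem_ker_thetaToEllM₂_iff p b).mp hy
  rw [← QuotientGroup.mk_mul, ← QuotientGroup.mk_mul, QuotientGroup.eq_iff_div_mem, mul_div_mul_eq_comm]
  exact commutatorElement_mem_KTheta₂ p ha (toHat_mem_deltaHat_of_mem_KEll₂ p hb)

/-- `Δ_Θ` is central in `(Δ^tp_X)^Θ` in the finer model. [cite: MochizukiEtTh2009, §1 p.12] -/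
theorem ker_thetaToEllM₂_central :
    ∀ x ∈ (thetaToEllM₂ p).ker, ∀ y ∈ ((curve₂ p).aug.toMonoidHom.ker).map (toThetaM₂ p), x * y = y * x := by
  intro x hx y hy
  obtain ⟨a, rfl⟩ := QuotientGroup.mk_surjective x
  obtain ⟨c, hc, rfl⟩ := hy
  have ha := (mk_mem_ker_thetaToEllM₂_iff p a).mp hx
  show (a : GTheta₂ p) * (c : GTheta₂ p) = (c : GTheta₂ p) * (a : GTheta₂ p)
  rw [← QuotientGroup.mk_mul, ← QuotientGroup.mk_mul, QuotientGroup.eq_iff_div_mem, mul_div_mul_eq_comm]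
  exact commutatorElement_mem_KTheta₂ p ha (toHat_mem_deltaHat_of_mem_deltaTemp₂ p hc)

/-! ### `Π^tp_X ↠ Z := pr₂` -/

/-- `Π^tp_X ↠ Z` of the finer model: `pr₂` on the fibre product. [cite: MochizukiEtTh2009, §1 p.12] -/
def toZM₂ : PiTp₂ p →* Multiplicative ℤ := gfpSnd.comp (MonoidHom.fst Gfp (Gam p))

/-- [cite: MochizukiEtTh2009, §1 p.12] -/
theorem ker_toZM₂ : (toZM₂ p).ker = (gfpSnd.ker).prod (⊤ : Subgroup (Gam p)) := by
  ext g; simp [toZM₂, MonoidHom.mem_ker, Subgroup.mem_prod]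

/-- [cite: MochizukiEtTh2009, §1 p.12] -/
theorem toZM₂_surjective : Surjective (toZM₂ p) := fun n => by
  obtain ⟨γ, hγ⟩ := gfpSnd_surjective n
  exact ⟨(γ, 1), hγ⟩

/-- Already `Δ^tp_X ↠ Z` is onto. [cite: MochizukiEtTh2009, §1 p.16] -/
theorem toZM₂_delta_surjective : Surjective ((toZM₂ p).restrict (curve₂ p).aug.toMonoidHom.ker) := fun n => by
  obtain ⟨γ, hγ⟩ := gfpSnd_surjective n
  exact ⟨⟨(γ, 1), (mem_deltaTemp₂_iff p _).mpr rfl⟩, hγ⟩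

/-- `Ker(Π^tp_X ↠ Z)` is open (NOT everything is open any more: `Π^tp` is not discrete).
[cite: MochizukiEtTh2009, §1 p.12] -/
theorem isOpen_ker_toZM₂ : IsOpen ((toZM₂ p).ker : Set (PiTp₂ p)) := by
  rw [ker_toZM₂, Subgroup.coe_prod]
  exact isOpen_ker_gfpSnd.prod isOpen_univ

/-! ### The coverings `Y_N`, `Z_N` and the inhabitant -/

/-- `Π^tp_{Y_N} := Δ^tp_{Y_N} × G_{K_N}`. [cite: MochizukiEtTh2009, §1 p.13] -/
def YN₂ (N : ℕ+) : Subgroup (PiTp₂ p) := (dY N).prod (gKN p N)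

/-- `Π^tp_{Z_N} := Δ^tp_{Z_N} × G_{J_N}`. [cite: MochizukiEtTh2009, §1 p.14] -/
def ZN₂ (N : ℕ+) : Subgroup (PiTp₂ p) := (dZ N).prod (gJN p N)

/-- [folklore] -/
private theorem qModel_mem_bot₂ : qModel p ∈ (⊥ : IntermediateField ℚ_[p] (PadicAlgCl p)) :=
  pow_mem (natCast_mem _ p) 2

/-- [folklore] -/
private theorem qModel_ne_zero₂ : qModel p ≠ 0 :=
  pow_ne_zero 2 (Nat.cast_ne_zero.mpr (Fact.out : p.Prime).ne_zero)

/-- [folklore] -/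
private theorem map_aug_prod₂ (A : Subgroup Gfp) (B : Subgroup (GQp p)) :
    (A.prod (B.comap (Gam.toGQp p).toMonoidHom)).map (curve₂ p).aug.toMonoidHom = B := by
  ext σ
  constructor
  · rintro ⟨x, ⟨-, hx⟩, rfl⟩; exact hx
  · intro hσ; exact ⟨((1 : Gfp), (σ : Gam p)), ⟨A.one_mem, hσ⟩, rfl⟩

/-- [folklore] -/
private theorem prod_inf_deltaTemp₂ (A : Subgroup Gfp) (B : Subgroup (Gam p)) :
    A.prod B ⊓ (curve₂ p).aug.toMonoidHom.ker = A.prod ⊥ := by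
  ext g
  rw [Subgroup.mem_inf, Subgroup.mem_prod, Subgroup.mem_prod, Subgroup.mem_bot]
  constructor
  · rintro ⟨⟨h1, -⟩, h3⟩; exact ⟨h1, (mem_deltaTemp₂_iff p g).mp h3⟩
  · rintro ⟨h1, h2⟩; exact ⟨⟨h1, by rw [h2]; exact B.one_mem⟩, (mem_deltaTemp₂_iff p g).mpr h2⟩

/-- [folklore] -/
private theorem relIndex_prod_bot₂ (A' A : Subgroup Gfp) :
    ((A'.prod (⊥ : Subgroup (Gam p))).relIndex (A.prod ⊥)) = A'.relIndex A := by
  have h1 : ∀ B : Subgroup Gfp, B.prod (⊥ : Subgroup (Gam p)) = B.map (MonoidHom.inl Gfp (Gam p)) := by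
    intro B; ext x; constructor
    · rintro ⟨hx1, hx2⟩; exact ⟨x.1, hx1, Prod.ext rfl ((Subgroup.mem_bot.mp hx2).symm)⟩
    · rintro ⟨b, hb, rfl⟩; exact ⟨hb, Subgroup.mem_bot.mpr rfl⟩
  have hinj : Injective (MonoidHom.inl Gfp (Gam p)) := fun a b h => congrArg Prod.fst h
  have h2 := Subgroup.relIndex_comap (A'.map (MonoidHom.inl Gfp (Gam p))) (MonoidHom.inl Gfp (Gam p)) A
  rw [Subgroup.comap_map_eq_self_of_injective hinj] at h2
  rw [h1, h1, ← h2]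

/-- [cite: MochizukiEtTh2009, §1 p.14] -/
theorem YN₂_one : YN₂ p 1 = (toZM₂ p).ker := by
  rw [ker_toZM₂, YN₂, dY_one, gKN, fieldKN_bot_one _ (qModel_mem_bot₂ p), IntermediateField.fixingSubgroup_bot,
    Subgroup.comap_top]

/-- [cite: MochizukiEtTh2009, §1 p.13] -/
theorem YN₂_le (N : ℕ+) : YN₂ p N ≤ (toZM₂ p).ker := by
  rw [ker_toZM₂]; exact Subgroup.prod_mono (dY_le N) le_top

/-- [cite: MochizukiEtTh2009, §1 p.14] -/
theorem YN₂_normal (N : ℕ+) : (YN₂ p N).Normal := by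
  haveI := dY_normal N
  haveI := fixingSubgroup_fieldKN_bot_normal _ (qModel_mem_bot₂ p) N
  haveI : (gKN p N).Normal := Subgroup.Normal.comap inferInstance _
  exact Subgroup.prod_normal _ _

/-- [cite: MochizukiEtTh2009, §1 p.15] -/
theorem ZN₂_normal (N : ℕ+) : (ZN₂ p N).Normal := by
  haveI := dZ_normal N
  haveI := fixingSubgroup_fieldJN_bot_normal _ (qModel_mem_bot₂ p) N
  haveI : (gJN p N).Normal := Subgroup.Normal.comap inferInstance _
  exact Subgroup.prod_normal _ _

/-- [cite: MochizukiEtTh2009, §1 p.13] -/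
theorem isOpen_YN₂ (N : ℕ+) : IsOpen (YN₂ p N : Set (PiTp₂ p)) := by
  rw [YN₂, Subgroup.coe_prod]; exact (isOpen_dY N).prod (isOpen_discrete _)

/-- [cite: MochizukiEtTh2009, §1 p.14] -/
theorem isOpen_ZN₂ (N : ℕ+) : IsOpen (ZN₂ p N : Set (PiTp₂ p)) := by
  rw [ZN₂, Subgroup.coe_prod]; exact (isOpen_dZ N).prod (isOpen_discrete _)

/-- **The finer model of the [EtTh] §1 root.** [cite: MochizukiEtTh2009, §1 p.11] -/
abbrev _root_.Literature.AnabelianGeometry.EtaleTheta.ThetaSetting.model₂ : ThetaSetting p where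
  toTemperedCurve := curve₂ p
  qX := qModel p
  qX_mem := qModel_mem_bot₂ p
  norm_qX_lt_one := (ThetaSetting.model p).norm_qX_lt_one
  qX_ne_zero := qModel_ne_zero₂ p
  sqrtqX := ((p : ℕ) : PadicAlgCl p)
  sqrtqX_sq := rfl
  toZ := toZM₂ p
  toZ_surjective := toZM₂_surjective p
  isOpen_ker_toZ := isOpen_ker_toZM₂ p
  toZ_delta_surjective := toZM₂_delta_surjective p
  GtpTheta := GTheta₂ p
  toTheta := toThetaM₂ p
  continuous_toTheta := QuotientGroup.continuous_mk (N := KTheta₂ p)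
  toTheta_surjective := QuotientGroup.mk'_surjective _
  ker_toTheta := QuotientGroup.ker_mk' _
  GtpEll := GEll₂ p
  thetaToEll := thetaToEllM₂ p
  continuous_thetaToEll := by
    refine (QuotientGroup.isOpenQuotientMap_mk (N := KTheta₂ p)).isQuotientMap.continuous_iff.mpr ?_
    show Continuous fun x => thetaToEllM₂ p (toThetaM₂ p x)
    simp_rw [← MonoidHom.comp_apply, thetaToEllM₂_comp]
    exact QuotientGroup.continuous_mk (N := KEll₂ p)
  thetaToEll_surjective y := by
    obtain ⟨b, rfl⟩ := QuotientGroup.mk_surjective y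
    exact ⟨(b : GTheta₂ p), rfl⟩
  ker_toEll := ker_toEllM₂ p
  ker_thetaToEll_comm := ker_thetaToEllM₂_comm p
  ker_thetaToEll_central := ker_thetaToEllM₂_central p
  GtpYN := YN₂ p
  GtpYN_one := YN₂_one p
  GtpYN_le := YN₂_le p
  map_aug_GtpYN N := map_aug_prod₂ p _ _
  GtpYN_normal := YN₂_normal p
  isOpen_GtpYN := isOpen_YN₂ p
  GtpYN_anti M N h := Subgroup.prod_mono (dY_anti h)
    (Subgroup.comap_mono (IntermediateField.fixingSubgroup_antitone (fieldKN_bot_mono _ (qModel_ne_zero₂ p) h)))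
  relIndex_deltaYN N := by
    rw [ker_toZM₂, YN₂, prod_inf_deltaTemp₂, prod_inf_deltaTemp₂, relIndex_prod_bot₂, relIndex_dY]
  GtpZN := ZN₂ p
  GtpZN_le N := Subgroup.prod_mono (dZ_le_dY N)
    (Subgroup.comap_mono (IntermediateField.fixingSubgroup_antitone (fieldKN_le_fieldJN _ ⊥ N)))
  map_aug_GtpZN N := map_aug_prod₂ p _ _
  GtpZN_normal := ZN₂_normal p
  isOpen_GtpZN := isOpen_ZN₂ p
  GtpZN_anti M N h := Subgroup.prod_mono (dZ_anti h)
    (Subgroup.comap_mono (IntermediateField.fixingSubgroup_antitone (fieldJN_bot_mono _ (qModel_ne_zero₂ p) h)))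
  relIndex_deltaZN N := by
    rw [ZN₂, YN₂, prod_inf_deltaTemp₂, prod_inf_deltaTemp₂, relIndex_prod_bot₂, relIndex_dZ]
  ker_toTheta_le_GtpZN N := by
    intro g hg'
    obtain ⟨hg, hgY⟩ := Subgroup.mem_inf.mp hg'
    rw [toThetaM₂, QuotientGroup.ker_mk'] at hg
    obtain ⟨h1, h2⟩ := hHat_eq_one_and_snd_eq_one_of_mem_KTheta₂ p hg N
    have hgY1 : g.1 ∈ gfpSnd.ker := (Subgroup.mem_inf.mp (Subgroup.mem_prod.mp hgY).1).1
    refine Subgroup.mem_prod.mpr ⟨Subgroup.mem_inf.mpr ⟨hgY1, ?_⟩, ?_⟩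
    · rw [MonoidHom.mem_ker]; exact h1
    · show g.2 ∈ gJN p N
      rw [h2]; exact (gJN p N).one_mem

/-- The finer model satisfies the guard. [cite: MochizukiEtTh2009, §1 p.12] -/
theorem _root_.Literature.AnabelianGeometry.EtaleTheta.ThetaSetting.model₂_isEtThOrigin :
    (ThetaSetting.model₂ p).IsEtThOrigin :=
  ThetaSetting.IsEtThOrigin.of_free (isFreeProfiniteOnTwo_deltaHat₂ p)

/-- **The image of `Δ^tp_Y` in `Π_X` is `Ker ê × 1`** (finer model). [cite: MochizukiEtTh2009, §1 p.12] -/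
theorem map_dtpY_model₂ : (ThetaSetting.model₂ p).DtpY.map (ThetaSetting.model₂ p).toHat.toMonoidHom =
    (eHat.toMonoidHom.ker).prod (⊥ : Subgroup (GamHatT p)) := by
  ext ⟨x, y⟩
  constructor
  · rintro ⟨g, ⟨hg1, hg2⟩, hgx⟩
    have hsnd : ((g.1 : F₂hatT × Multiplicative ℤ)).2 = 1 := hg1
    have h2 : g.2 = 1 := hg2
    rw [Prod.ext_iff] at hgx
    obtain ⟨rfl, rfl⟩ := hgx
    refine ⟨?_, ?_⟩
    · show eHat ((g.1 : F₂hatT × Multiplicative ℤ)).1 = 1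
      rw [(mem_Gfp _).mp g.1.2, hsnd, map_one]
    · show etaGam p g.2 ∈ (⊥ : Subgroup _)
      rw [h2, map_one]; exact Subgroup.one_mem _
  · intro hxy
    obtain ⟨hx, hy⟩ := Subgroup.mem_prod.mp hxy
    have hy' : y = 1 := hy
    have hx' : eHat x = 1 := hx
    subst hy'
    refine ⟨(⟨(x, 1), by rw [mem_Gfp, hx', map_one]⟩, 1), Subgroup.mem_inf.mpr ⟨?_, ?_⟩, ?_⟩
    · show (1 : Multiplicative ℤ) = 1
      rfl
    · show (1 : Gam p) = 1
      rfl
    · exact Prod.ext rfl (show etaGam p 1 = 1 from map_one _)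

/-- **`hYcl` HOLDS in the finer model**: the image of `Δ^tp_Y` in `Π_X` is closed, so its closure lies in the
image itself (a fortiori in image `⊔ [[Δ_X,Δ_X],Δ_X]⁻`). [cite: MochizukiEtTh2009, §1 p.12] -/
theorem hYcl_model₂ :
    ((ThetaSetting.model₂ p).DtpY.map (ThetaSetting.model₂ p).toHat.toMonoidHom).topologicalClosure ≤
      (ThetaSetting.model₂ p).DtpY.map (ThetaSetting.model₂ p).toHat.toMonoidHom ⊔
        (⁅⁅(ThetaSetting.model₂ p).DeltaHat, (ThetaSetting.model₂ p).DeltaHat⁆,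
          (ThetaSetting.model₂ p).DeltaHat⁆).topologicalClosure := by
  refine (Subgroup.topologicalClosure_minimal _ le_rfl ?_).trans le_sup_left
  rw [map_dtpY_model₂, Subgroup.coe_prod]
  have : ((eHat.toMonoidHom.ker : Subgroup F₂hatT) : Set F₂hatT) = eHat ⁻¹' {1} := by
    ext; simp [MonoidHom.mem_ker]
  rw [this, Subgroup.coe_bot]
  exact (isClosed_singleton.preimage eHat.continuous).prod isClosed_singleton

/-- **Root + guard + `hYcl` are jointly satisfiable.** [cite: MochizukiEtTh2009, §1 p.12] -/
theorem _root_.Literature.AnabelianGeometry.EtaleTheta.ThetaSetting.exists_isEtThOrigin_and_hYcl :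
    ∃ D : ThetaSetting p, D.IsEtThOrigin ∧
      (D.DtpY.map D.toHat.toMonoidHom).topologicalClosure ≤
        D.DtpY.map D.toHat.toMonoidHom ⊔ (⁅⁅D.DeltaHat, D.DeltaHat⁆, D.DeltaHat⁆).topologicalClosure :=
  ⟨ThetaSetting.model₂ p, ThetaSetting.model₂_isEtThOrigin p, hYcl_model₂ p⟩

end Literature.AnabelianGeometry.EtaleTheta.SettingModel

end
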